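import Literature.NumberTheory.Transcendental.NesterenkoGenericSectionField
import Literature.NumberTheory.Transcendental.NesterenkoEliminationZerosK
import Literature.NumberTheory.Transcendental.NesterenkoFormsOnHyperplanesK
import Mathlib.FieldTheory.IsAlgClosed.AlgebraicClosure
import Mathlib.FieldTheory.PrimitiveElement
import Mathlib.FieldTheory.Perfect
import HarnessLib

/-!
# Towards LNM 1752 Ch. 3 Proposition 4.11, VI: the generic splitting of the associated form — the conjugates of the generic section point

`Literature/NumberTheory/Transcendental/NesterenkoGenericSplitting.lean`. Sixth step of the
discharge of the named fact `NesterenkoPhilippon2001_ch3_prop_4_11` (Nesterenko–Philippon (eds.),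
LNM 1752 (2001), Ch. 3 Prop. 4.11 = [Nes10, Prop. 1.4]); sequel of
`NesterenkoGenericSectionField.lean` (`GSec`, `𝕃 = 𝒢.LL ⊃ 𝕃₀ = 𝒢.L0 ⊃ K' = 𝒢.Kp`, the generic
section point `ρ`).

Let `F` be the associated form of the homogeneous prime `𝔭` (rank `s + 1`) in `s + 1` groups of
variables and `g(w) = F(u₁, …, u_s; w) ∈ K'[w₀, …, w_m]` its last group made the main variables
(`lastBlock`, `𝒢.gOm` = `g` with coefficients in an algebraic closure `Ω` of `𝕃`). We prove:

* every `K'`-embedding `σ : 𝕃₀ → Ω` gives a point `β_σ = σ(ρ) ∈ Ω^{m+1}` with `β_{σ,j} = 1`, a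
  zero of `𝔭` on the generic hyperplanes `L₁(u'), …, L_s(u')` (`embPt`, `aeval_embPt_eq_zero`,
  `sum_algebraMap_X_mul_embPt`), and `σ ↦ β_σ` is injective (`embPt_injective`);
* **every** such point `β` (over `Ω`) yields a linear factor `ℓ_β = ∑ βₖ wₖ` of `g`
  (`linK_dvd_gOm`: `g` vanishes on the hyperplane `β · w = 0` by the evaluation lemma
  `aeval_eq_zero_of_mem_elimIdeal_of_zero`, then the Nullstellensatz for `ℓ_β`);
* hence `∏_σ ℓ_{β_σ} ∣ g` and **`#{σ} = [𝕃₀ : K'] ≤ deg g ≤ D = deg 𝔭`** (`prod_linK_embPt_dvd_gOm`,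
  `finrank_L0_le_ideg`; `AlgHom.card`, characteristic zero).

The reverse inequality `[𝕃₀ : K'] ≥ D` (whence `g = a ∏_σ ℓ_{β_σ}`, the generic splitting) is the
sequel. Definitions here are plumbing with bodies (`lastBlock`, `GSec.Om`, `GSec.gOm`, `GSec.rhoL0`,
`GSec.embPt`); no named facts.

## References

* [NesterenkoPhilippon2001] LNM 1752 (2001), Ch. 3 §4, Prop. 4.4 (p. 38), Prop. 4.11 (pp. 40–41).
* [Nes10] Yu. V. Nesterenko, Proc. Steklov Inst. Math. 218 (1997) 294–331, §1.
* [HodgePedoe1994] W. V. D. Hodge, D. Pedoe, *Methods of Algebraic Geometry* II, Ch. X §§6–8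
  (the Cayley form splits over the conjugates of the generic points of a linear section).
-/

noncomputable section

open MvPolynomial Module

attribute [local instance] MvPolynomial.gradedAlgebra

namespace Literature.NumberTheory.Transcendental

namespace Nesterenko

variable {m : ℕ}

/-! ### The last group of variables as main variables: `F ↦ F(u₁, …, u_s; w)` -/

/-- `F(u₁, …, u_s; w) ∈ ℚ[U'][w₀, …, w_m]`: the last group of variables of `F ∈ ℚ[u₁, …, u_{s+1}]`
made the main variables. [folklore] -/
def lastBlock (s : ℕ) : RU (s + 1) m →ₐ[ℚ] MvPolynomial (Fin (m + 1)) (RU s m) :=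
  aeval fun v : Fin (s + 1) × Fin (m + 1) =>
    Fin.lastCases (motive := fun _ => MvPolynomial (Fin (m + 1)) (RU s m)) (X v.2)
      (fun i => C (X (i, v.2))) v.1

/-- `lastBlock` on a variable of the first `s` groups. [folklore] -/
theorem lastBlock_X_castSucc (s : ℕ) (i : Fin s) (k : Fin (m + 1)) :
    lastBlock (m := m) s (X (Fin.castSucc i, k)) = C (X (i, k)) := by
  simp [lastBlock]

/-- `lastBlock` on a variable of the last group. [folklore] -/
theorem lastBlock_X_last (s : ℕ) (k : Fin (m + 1)) :
    lastBlock (m := m) s (X (Fin.last s, k)) = X k := by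
  simp [lastBlock]

/-- **Evaluation of `F(u₁, …, u_s; w)`**: evaluating the coefficients by `f : ℚ[U'] → B` and the main
variables at `w` is evaluating `F` at `(f(u'), w)`. [folklore] -/
theorem eval₂_lastBlock {B : Type*} [CommRing B] (s : ℕ) (f : RU s m →+* B) (w : Fin (m + 1) → B)
    (G : RU (s + 1) m) :
    eval₂ f w (lastBlock s G) =
      eval₂ (f.comp (algebraMap ℚ (RU s m))) (fun v : Fin (s + 1) × Fin (m + 1) =>
        Fin.lastCases (motive := fun _ => B) (w v.2) (fun i => f (X (i, v.2))) v.1) G := by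
  have h : ((eval₂Hom f w).comp (lastBlock (m := m) s).toRingHom) =
      eval₂Hom (f.comp (algebraMap ℚ (RU s m))) (fun v : Fin (s + 1) × Fin (m + 1) =>
        Fin.lastCases (motive := fun _ => B) (w v.2) (fun i => f (X (i, v.2))) v.1) := by
    refine MvPolynomial.ringHom_ext (fun a => ?_) (fun v => ?_)
    · simp only [RingHom.comp_apply, AlgHom.toRingHom_eq_coe, RingHom.coe_coe, coe_eval₂Hom,
        eval₂_C]
      rw [MvPolynomial.algHom_C, MvPolynomial.algebraMap_apply, eval₂_C, MvPolynomial.algebraMap_eq]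
    · rcases v with ⟨i, k⟩
      simp only [RingHom.comp_apply, AlgHom.toRingHom_eq_coe, RingHom.coe_coe, coe_eval₂Hom,
        eval₂_X]
      refine Fin.lastCases ?_ (fun i => ?_) i
      · rw [lastBlock_X_last, eval₂_X, Fin.lastCases_last]
      · rw [lastBlock_X_castSucc, eval₂_C, Fin.lastCases_castSucc]
  exact RingHom.congr_fun h G

/-- `F(u₁, …, u_s; w)` is homogeneous of degree `N` in `w` if `F` is homogeneous of degree `N` in its
last group. [folklore] -/
theorem isHomogeneous_lastBlock (s : ℕ) {F : RU (s + 1) m} {N : ℕ}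
    (hF : ∀ γ ∈ F.support, ∑ k : Fin (m + 1), γ (Fin.last s, k) = N) :
    (lastBlock s F).IsHomogeneous N := by
  classical
  rw [F.as_sum, map_sum]
  refine IsHomogeneous.sum _ _ _ fun γ hγ => ?_
  rw [lastBlock, aeval_monomial, Finsupp.prod_pow, Fintype.prod_prod_type, Fin.prod_univ_castSucc]
  simp only [Fin.lastCases_castSucc, Fin.lastCases_last]
  have hC : (∏ i : Fin s, ∏ k : Fin (m + 1),
      (C (X (i, k)) : MvPolynomial (Fin (m + 1)) (RU s m)) ^ γ (Fin.castSucc i, k)) = C (firstMono s γ) := by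
    simp only [firstMono, map_prod, C_pow]
  have h2 : (∏ k : Fin (m + 1), (X k : MvPolynomial (Fin (m + 1)) (RU s m)) ^ γ (Fin.last s, k)).IsHomogeneous
      (∑ k : Fin (m + 1), γ (Fin.last s, k)) :=
    IsHomogeneous.prod _ _ _ fun k _ => isHomogeneous_X_pow _ _
  rw [hF γ hγ] at h2
  rw [hC, ← mul_assoc, MvPolynomial.algebraMap_apply, ← map_mul]
  exact h2.C_mul _

/-- `F(u₁, …, u_s; e_j) = a` (`aLead`): evaluating the main variables at `e_j`. [folklore] -/
theorem eval₂_lastBlock_indicator {B : Type*} [CommRing B] (s : ℕ) (f : RU s m →+* B)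
    (j : Fin (m + 1)) (G : RU (s + 1) m) :
    eval₂ f (fun k => if k = j then 1 else 0) (lastBlock s G) = f (aLead s j G) := by
  rw [eval₂_lastBlock, aLead, aeval_def, eval₂_comp_left]
  congr 1
  funext v
  rcases v with ⟨i, k⟩
  refine Fin.lastCases ?_ (fun i => ?_) i
  · simp only [Fin.lastCases_last, Function.comp_apply]
    split_ifs <;> simp
  · simp

/-- Ring homomorphisms commute with evaluation of RATIONAL polynomials (`ℚ → B` is unique).
[folklore] -/
theorem ringHom_aeval_rat {σ S T : Type*} [CommRing S] [CommRing T] [Algebra ℚ S] [Algebra ℚ T]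
    (ψ : S →+* T) (x : σ → S) (P : MvPolynomial σ ℚ) : ψ (aeval x P) = aeval (fun i => ψ (x i)) P := by
  rw [aeval_def, aeval_def, eval₂_comp_left, Subsingleton.elim (ψ.comp (algebraMap ℚ S)) (algebraMap ℚ T)]
  rfl

namespace GSec

variable (𝒢 : GSec m)

/-! ### An algebraic closure `Ω` of `𝕃` and the section form `g` over `Ω` -/

/-- `Ω`, an algebraic closure of `𝕃`. [folklore] -/
abbrev Om : Type := AlgebraicClosure 𝒢.LL

/-- Short-cut instance. [folklore] -/
instance algebraKpOm : Algebra 𝒢.Kp 𝒢.Om := AlgebraicClosure.instAlgebra 𝒢.LL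

/-- Short-cut instance. [folklore] -/
instance smulKpOm : SMul 𝒢.Kp 𝒢.Om := Algebra.toSMul

/-- Short-cut instance. [folklore] -/
instance moduleKpOm : Module 𝒢.Kp 𝒢.Om := Algebra.toModule

/-- Short-cut instance. [folklore] -/
instance algebraAOm : Algebra (RU 𝒢.s m) 𝒢.Om := AlgebraicClosure.instAlgebra 𝒢.LL

/-- Short-cut instance. [folklore] -/
instance smulAOm : SMul (RU 𝒢.s m) 𝒢.Om := Algebra.toSMul

/-- Short-cut instance. [folklore] -/
instance towerKpLLOm : IsScalarTower 𝒢.Kp 𝒢.LL 𝒢.Om := AlgebraicClosure.instIsScalarTower 𝒢.LL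

/-- Short-cut instance. [folklore] -/
instance towerAKpOm : IsScalarTower (RU 𝒢.s m) 𝒢.Kp 𝒢.Om := AlgebraicClosure.instIsScalarTower 𝒢.LL

/-- Short-cut instance. [folklore] -/
instance towerALLOm : IsScalarTower (RU 𝒢.s m) 𝒢.LL 𝒢.Om := AlgebraicClosure.instIsScalarTower 𝒢.LL

/-- Short-cut instance. [folklore] -/
instance algebraL0Om : Algebra 𝒢.L0 𝒢.Om := AlgebraicClosure.instAlgebra 𝒢.LL

/-- Short-cut instance. [folklore] -/
instance smulL0Om : SMul 𝒢.L0 𝒢.Om := Algebra.toSMul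

/-- Short-cut instance. [folklore] -/
instance towerKpL0Om : IsScalarTower 𝒢.Kp 𝒢.L0 𝒢.Om := AlgebraicClosure.instIsScalarTower 𝒢.LL

/-- Short-cut instance. [folklore] -/
instance towerL0LLOm : IsScalarTower 𝒢.L0 𝒢.LL 𝒢.Om := AlgebraicClosure.instIsScalarTower 𝒢.LL

/-- **`g = F(u₁, …, u_s; w)` with coefficients in `Ω`** (`F` the associated form of `𝔭` in `s + 1`
groups). [cite: NesterenkoPhilippon2001, Ch. 3 Prop. 4.11 (pp. 40–41)] -/
def gOm : MvPolynomial (Fin (m + 1)) 𝒢.Om :=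
  map (algebraMap (RU 𝒢.s m) 𝒢.Om) (lastBlock 𝒢.s (chowForm 𝒢.𝔭 (𝒢.s + 1)))

/-- `g` is homogeneous of degree `D = deg 𝔭`. [folklore] -/
theorem isHomogeneous_gOm : 𝒢.gOm.IsHomogeneous (ideg 𝒢.𝔭 (𝒢.s + 1)) :=
  (isHomogeneous_lastBlock 𝒢.s fun _ hγ =>
    sum_last_eq_ideg_of_mem_support_chowForm 𝒢.𝔭 𝒢.s hγ).map _

/-- `deg g ≤ D`. [folklore] -/
theorem totalDegree_gOm_le : 𝒢.gOm.totalDegree ≤ ideg 𝒢.𝔭 (𝒢.s + 1) :=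
  𝒢.isHomogeneous_gOm.totalDegree_le

/-- `ℚ[U'] → Ω` is injective. [folklore] -/
theorem algebraMap_A_Om_injective : Function.Injective (algebraMap (RU 𝒢.s m) 𝒢.Om) := by
  rw [IsScalarTower.algebraMap_eq (RU 𝒢.s m) 𝒢.LL 𝒢.Om]
  exact (FaithfulSMul.algebraMap_injective 𝒢.LL 𝒢.Om).comp 𝒢.toLL_injective

/-- `g(e_j) = a ≠ 0`; in particular `g ≠ 0`. [folklore] -/
theorem eval_indicator_gOm :
    eval (fun k => if k = 𝒢.j then 1 else 0) 𝒢.gOm =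
      algebraMap (RU 𝒢.s m) 𝒢.Om (aLead 𝒢.s 𝒢.j (chowForm 𝒢.𝔭 (𝒢.s + 1))) := by
  rw [gOm, eval_map, eval₂_lastBlock_indicator]

/-- `g ≠ 0`. [folklore] -/
theorem gOm_ne_zero : 𝒢.gOm ≠ 0 := fun h => by
  have h1 := 𝒢.eval_indicator_gOm
  rw [h, map_zero] at h1
  exact aLead_chowForm_ne_zero 𝒢.prime 𝒢.hom 𝒢.rank 𝒢.chart
    (𝒢.algebraMap_A_Om_injective (by rw [← h1, map_zero]))

/-! ### Points from embeddings `σ : 𝕃₀ → Ω` -/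

/-- `ρ` as a tuple of elements of `𝕃₀`. [folklore] -/
def rhoL0 (k : Fin (m + 1)) : 𝒢.L0 := ⟨𝒢.rho k, 𝒢.rho_mem_L0 k⟩

/-- `rhoL0` coerced back to `𝕃`. [folklore] -/
theorem algebraMap_rhoL0 (k : Fin (m + 1)) : algebraMap 𝒢.L0 𝒢.LL (𝒢.rhoL0 k) = 𝒢.rho k := rfl

/-- `ρⱼ = 1` in `𝕃₀`. [folklore] -/
theorem rhoL0_j : 𝒢.rhoL0 𝒢.j = 1 :=
  (algebraMap 𝒢.L0 𝒢.LL).injective (by rw [algebraMap_rhoL0, rho_j, map_one])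

/-- `ρ ∈ 𝕃₀^{m+1}` is a zero of `𝔭`. [folklore] -/
theorem aeval_rhoL0_eq_zero {P : Rx m} (hP : P ∈ 𝒢.𝔭) : aeval 𝒢.rhoL0 P = 0 := by
  apply (algebraMap 𝒢.L0 𝒢.LL).injective
  rw [ringHom_aeval_rat, map_zero]
  exact 𝒢.aeval_rho_eq_zero hP

/-- `ρ ∈ 𝕃₀^{m+1}` lies on the generic hyperplanes. [folklore] -/
theorem sum_algebraMap_X_mul_rhoL0 (i : Fin 𝒢.s) :
    ∑ k : Fin (m + 1), algebraMap 𝒢.Kp 𝒢.L0 (algebraMap (RU 𝒢.s m) 𝒢.Kp (X (i, k))) * 𝒢.rhoL0 k = 0 := by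
  apply (algebraMap 𝒢.L0 𝒢.LL).injective
  rw [map_sum, map_zero, ← 𝒢.sum_algebraMap_X_mul_rho i]
  refine Finset.sum_congr rfl fun k _ => ?_
  rw [map_mul, algebraMap_rhoL0, ← IsScalarTower.algebraMap_apply, ← IsScalarTower.algebraMap_apply]

/-- **The point `β_σ = σ(ρ) ∈ Ω^{m+1}`** attached to a `K'`-embedding `σ : 𝕃₀ → Ω`.
[cite: NesterenkoPhilippon2001, Ch. 3 Prop. 4.11 (pp. 40–41)] -/
def embPt (σ : 𝒢.L0 →ₐ[𝒢.Kp] 𝒢.Om) (k : Fin (m + 1)) : 𝒢.Om := σ (𝒢.rhoL0 k)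

/-- `β_{σ,j} = 1`. [folklore] -/
theorem embPt_j (σ : 𝒢.L0 →ₐ[𝒢.Kp] 𝒢.Om) : 𝒢.embPt σ 𝒢.j = 1 := by
  rw [embPt, rhoL0_j, map_one]

/-- `β_σ ≠ 0`. [folklore] -/
theorem embPt_ne_zero (σ : 𝒢.L0 →ₐ[𝒢.Kp] 𝒢.Om) : 𝒢.embPt σ ≠ 0 := fun h => by
  have := congrFun h 𝒢.j
  rw [embPt_j] at this
  exact one_ne_zero this

/-- **`β_σ` is a zero of `𝔭`.** [cite: NesterenkoPhilippon2001, Ch. 3 Prop. 4.11 (pp. 40–41)] -/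
theorem aeval_embPt_eq_zero (σ : 𝒢.L0 →ₐ[𝒢.Kp] 𝒢.Om) {P : Rx m} (hP : P ∈ 𝒢.𝔭) :
    aeval (𝒢.embPt σ) P = 0 := by
  have h := ringHom_aeval_rat (σ : 𝒢.L0 →+* 𝒢.Om) 𝒢.rhoL0 P
  rw [𝒢.aeval_rhoL0_eq_zero hP, map_zero] at h
  exact h.symm

/-- **`β_σ` lies on the generic hyperplanes** `L₁(u'), …, L_s(u')`.
[cite: NesterenkoPhilippon2001, Ch. 3 Prop. 4.11 (pp. 40–41)] -/
theorem sum_algebraMap_X_mul_embPt (σ : 𝒢.L0 →ₐ[𝒢.Kp] 𝒢.Om) (i : Fin 𝒢.s) :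
    ∑ k : Fin (m + 1), algebraMap (RU 𝒢.s m) 𝒢.Om (X (i, k)) * 𝒢.embPt σ k = 0 := by
  have h := congrArg σ (𝒢.sum_algebraMap_X_mul_rhoL0 i)
  rw [map_sum, map_zero] at h
  rw [← h]
  refine Finset.sum_congr rfl fun k _ => ?_
  rw [map_mul, AlgHom.commutes, embPt, ← IsScalarTower.algebraMap_apply]

/-- `σ ↦ β_σ` is injective (`ρ` generates `𝕃₀` over `K'`). [folklore] -/
theorem embPt_injective : Function.Injective 𝒢.embPt := by
  intro σ τ h
  refine IntermediateField.algHom_ext_of_eq_adjoin (F := 𝒢.Kp) (s := Set.range 𝒢.rho)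
    (S := 𝒢.L0) rfl ?_
  rintro x ⟨k, rfl⟩
  exact congrFun h k

/-! ### Linear factors of `g` from section points -/

/-- **Every zero `β ∈ Ω^{m+1} ∖ 0` of `𝔭` on the generic hyperplanes yields a linear factor
`ℓ_β = ∑ₖ βₖ wₖ` of `g = F(u₁, …, u_s; w)`**: `g` vanishes on the hyperplane `β · w = 0` by the
evaluation lemma for `F ∈ Ī(s+1)`. [cite: NesterenkoPhilippon2001, Ch. 3 Prop. 4.4 (p. 38), Prop. 4.11 (pp. 40–41)] -/
theorem linK_dvd_gOm {β : Fin (m + 1) → 𝒢.Om} (hβ0 : β ≠ 0) (hβI : ∀ P ∈ 𝒢.𝔭, aeval β P = 0)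
    (hL : ∀ i : Fin 𝒢.s, ∑ k : Fin (m + 1), algebraMap (RU 𝒢.s m) 𝒢.Om (X (i, k)) * β k = 0) :
    ((∑ k, C (β k) * X k) : MvPolynomial (Fin (m + 1)) 𝒢.Om) ∣ 𝒢.gOm := by
  refine linK_dvd_of_forall_eval hβ0 fun w hw => ?_
  rw [gOm, eval_map, eval₂_lastBlock]
  set u : Fin (𝒢.s + 1) × Fin (m + 1) → 𝒢.Om := fun v =>
    Fin.lastCases (motive := fun _ => 𝒢.Om) (w v.2)
      (fun i => algebraMap (RU 𝒢.s m) 𝒢.Om (X (i, v.2))) v.1 with hu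
  have hLu : ∀ i : Fin (𝒢.s + 1), ∑ k : Fin (m + 1), u (i, k) * β k = 0 := by
    intro i
    refine Fin.lastCases ?_ (fun i => ?_) i
    · simp only [hu, Fin.lastCases_last]
      rw [← hw]
      exact Finset.sum_congr rfl fun k _ => mul_comm _ _
    · simp only [hu, Fin.lastCases_castSucc]
      exact hL i
  have key := aeval_eq_zero_of_mem_elimIdeal_of_zero (K := 𝒢.Om) 𝒢.chowForm_mem hβ0 hβI hLu
  rw [aeval_def] at key
  rw [Subsingleton.elim ((algebraMap (RU 𝒢.s m) 𝒢.Om).comp (algebraMap ℚ (RU 𝒢.s m)))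
    (algebraMap ℚ 𝒢.Om)]
  exact key

/-- In particular `ℓ_{β_σ} ∣ g` for every embedding `σ`. [folklore] -/
theorem linK_embPt_dvd_gOm (σ : 𝒢.L0 →ₐ[𝒢.Kp] 𝒢.Om) :
    ((∑ k, C (𝒢.embPt σ k) * X k) : MvPolynomial (Fin (m + 1)) 𝒢.Om) ∣ 𝒢.gOm :=
  𝒢.linK_dvd_gOm (𝒢.embPt_ne_zero σ) (fun _ hP => 𝒢.aeval_embPt_eq_zero σ hP)
    (𝒢.sum_algebraMap_X_mul_embPt σ)

/-! ### Counting: `[𝕃₀ : K'] ≤ deg 𝔭` -/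

/-- Points with `j`-th coordinate `1` are proportional only if equal. [folklore] -/
theorem eq_of_smul_of_apply_eq_one {K : Type*} [Field K] {β β' : Fin (m + 1) → K} {j : Fin (m + 1)}
    (hβ : β j = 1) (hβ' : β' j = 1) {c : K} (h : β' = c • β) : β' = β := by
  have hc : c = 1 := by
    have := congrFun h j
    rw [Pi.smul_apply, smul_eq_mul, hβ, hβ', mul_one] at this
    exact this.symm
  rw [h, hc, one_smul]

/-- **`∏_σ ℓ_{β_σ} ∣ g`** over all the `K'`-embeddings `σ : 𝕃₀ → Ω`.
[cite: NesterenkoPhilippon2001, Ch. 3 Prop. 4.11 (pp. 40–41)] -/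
theorem prod_linK_embPt_dvd_gOm :
    (∏ σ : 𝒢.L0 →ₐ[𝒢.Kp] 𝒢.Om, (∑ k, C (𝒢.embPt σ k) * X k) : MvPolynomial (Fin (m + 1)) 𝒢.Om) ∣
      𝒢.gOm := by
  classical
  have h := prod_linK_dvd (g := 𝒢.gOm) (Finset.univ.image 𝒢.embPt) ?_ ?_ ?_
  · rwa [Finset.prod_image fun σ _ τ _ h => 𝒢.embPt_injective h] at h
  · rintro β hβ
    obtain ⟨σ, -, rfl⟩ := Finset.mem_image.mp hβ
    exact 𝒢.embPt_ne_zero σ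
  · rintro β hβ β' hβ' hne c hc
    obtain ⟨σ, -, rfl⟩ := Finset.mem_image.mp hβ
    obtain ⟨τ, -, rfl⟩ := Finset.mem_image.mp hβ'
    exact hne (eq_of_smul_of_apply_eq_one (𝒢.embPt_j σ) (𝒢.embPt_j τ) hc).symm
  · rintro β hβ
    obtain ⟨σ, -, rfl⟩ := Finset.mem_image.mp hβ
    exact 𝒢.linK_embPt_dvd_gOm σ

/-- **The number of `K'`-embeddings `𝕃₀ → Ω` is at most `deg 𝔭`.**
[cite: NesterenkoPhilippon2001, Ch. 3 Prop. 4.11 (pp. 40–41)] -/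
theorem card_embeddings_le : Fintype.card (𝒢.L0 →ₐ[𝒢.Kp] 𝒢.Om) ≤ ideg 𝒢.𝔭 (𝒢.s + 1) := by
  classical
  have h := card_le_totalDegree_of_linK_dvd 𝒢.gOm_ne_zero (Finset.univ.image 𝒢.embPt) ?_ ?_ ?_
  · rw [Finset.card_image_of_injective _ 𝒢.embPt_injective, Finset.card_univ] at h
    exact h.trans 𝒢.totalDegree_gOm_le
  · rintro β hβ
    obtain ⟨σ, -, rfl⟩ := Finset.mem_image.mp hβ
    exact 𝒢.embPt_ne_zero σ
  · rintro β hβ β' hβ' hne c hc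
    obtain ⟨σ, -, rfl⟩ := Finset.mem_image.mp hβ
    obtain ⟨τ, -, rfl⟩ := Finset.mem_image.mp hβ'
    exact hne (eq_of_smul_of_apply_eq_one (𝒢.embPt_j σ) (𝒢.embPt_j τ) hc).symm
  · rintro β hβ
    obtain ⟨σ, -, rfl⟩ := Finset.mem_image.mp hβ
    exact 𝒢.linK_embPt_dvd_gOm σ

/-- `K'` has characteristic zero. [folklore] -/
instance charZero_Kp : CharZero 𝒢.Kp :=
  charZero_of_injective_algebraMap (IsFractionRing.injective (RU 𝒢.s m) 𝒢.Kp)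

/-- `K'` is perfect. [folklore] -/
instance perfectField_Kp : PerfectField 𝒢.Kp := PerfectField.ofCharZero

/-- `𝕃₀ / K'` is separable (characteristic zero). [folklore] -/
instance isSeparable_L0 : Algebra.IsSeparable 𝒢.Kp 𝒢.L0 :=
  Algebra.IsAlgebraic.isSeparable_of_perfectField

/-- **`[𝕃₀ : K'] ≤ deg 𝔭`** (the embeddings are `[𝕃₀ : K']` in number in characteristic zero).
[cite: NesterenkoPhilippon2001, Ch. 3 Prop. 4.11 (pp. 40–41)] -/
theorem finrank_L0_le_ideg : finrank 𝒢.Kp 𝒢.L0 ≤ ideg 𝒢.𝔭 (𝒢.s + 1) := by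
  rw [← AlgHom.card 𝒢.Kp 𝒢.L0 𝒢.Om]
  exact 𝒢.card_embeddings_le

end GSec

end Nesterenko

end Literature.NumberTheory.Transcendental

end
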